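import Summits.CriticalPhenomena.PercolationContinuityZ3.Theorems.Transplant.FKConnectivityAllQAntipodalOrAttSides
import HarnessLib

/-!
# Connectivity correlation inequalities for `φ_{w,q}`, every `q > 0` — file 48a: the `maj₃` functional as FOUR two-sided drifts — the
# ROOT-EXCHANGE identities and the signed piece `D(yC|C) − D(C|yC)` (towards the `q`-free `maj₃` at a SEPARATING junction)

Support file (`--supports stmt-CriticalPhenomena-4575`), FK sub-lane `prim-bschramm-fk-2` (gen 22); builds on p205010 (kernel theorem,
internal audit signed; external expert review pending).  No definitions, no named facts, no sorries; standard axioms.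

Rooted at `x = st`, `Ψ^w(maj₃(x,y,z), g) = 2·M`, `M = D(yzC|C) + D(zC|yC) + D(yC|zC) − D(C|yzC)` (two-sided drifts as in `…OrAttSides`).  At a
junction separating `y` from `z` the drifts `D(yC|zC)` and `−D(C|yzC)` carry the same far-side data, and on the near side they leave the
DIFFERENCE `Δ = D^{e}(yC₁|C₁) − D^{e}(C₁|yC₁)` (`e` the virtual root).  This file proves `Δ ≤ 0` in every position of `e`
(`FK.majDiffW_nonpos_of_isTTSP`) from three identities: `e ∉ N`: `Δ` is the drift ROOTED AT `y` of the free set `N ∪ {e}` (`FK.twoSidedW_diff_root_eq`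
— the root and the inserted edge exchange their roles); `e ∈ N`: `Δ = D°_N(yC|C)(h) + D°_{N∖e}(yCe|Ce)(h + h(·∪e))` (`FK.twoSidedW_diff_root_mem_eq`);
`e ∈ C` or `e = y`: rootless.  All pieces are instances of the master weighted AND theorem (`…AndGenWeightPath` via `…OrAttSides`).
[cite: Grimmett2006, §1.4 eq. (1.20) (p. 15); §3.8 Thm. (3.90) (pp. 61–62); §3.9 (pp. 63–64)] [cite: Wagner2006, Thm. 5.8(d), §5.3]
-/

noncomputable section

namespace Summit.CriticalPhenomena.PercolationContinuityZ3.Theorems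

namespace FK

open SimpleGraph Literature.Probability.LatticeModels Literature.Probability.Percolation
open scoped Classical

variable {V : Type*} [Fintype V]

section MajSplitSides

omit [Fintype V] in
/-- **Root exchange (`e ∉ N`).**  `D^{e}(yA | B) − D^{e}(A | yB)` on the free set `N` equals the drift with ROOT `y` of the free set `N ∪ {e}`
(attachments `A | B`) against `h(· \ e)`. [cite: Grimmett2006, §1.4 eq. (1.20) (p. 15)] -/
theorem twoSidedW_diff_root_eq (w : ℕ → ℝ) {N : Finset (Sym2 V)} (C : Finset (Sym2 V)) {e : Sym2 V} (y : Sym2 V) (he : e ∉ N)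
    (h : Finset (Sym2 V) → ℝ) :
    ∑ γ ∈ N.powerset,
        (w (clusterCount (↑(insert e (γ ∪ insert y C)) : BondConfig V) ∅ + clusterCount (↑(N \ γ ∪ C) : BondConfig V) ∅) -
          w (clusterCount (↑(insert e (N \ γ ∪ insert y C)) : BondConfig V) ∅ + clusterCount (↑(γ ∪ C) : BondConfig V) ∅)) * h γ -
      ∑ γ ∈ N.powerset,
        (w (clusterCount (↑(insert e (γ ∪ C)) : BondConfig V) ∅ + clusterCount (↑(N \ γ ∪ insert y C) : BondConfig V) ∅) -
          w (clusterCount (↑(insert e (N \ γ ∪ C)) : BondConfig V) ∅ + clusterCount (↑(γ ∪ insert y C) : BondConfig V) ∅)) * h γ =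
      ∑ γ ∈ (insert e N).powerset,
        (w (clusterCount (↑(insert y (γ ∪ C)) : BondConfig V) ∅ + clusterCount (↑(insert e N \ γ ∪ C) : BondConfig V) ∅) -
          w (clusterCount (↑(insert y (insert e N \ γ ∪ C)) : BondConfig V) ∅ + clusterCount (↑(γ ∪ C) : BondConfig V) ∅)) *
          h (γ.erase e) := by
  rw [Finset.sum_powerset_insert he, add_comm, ← Finset.sum_sub_distrib, ← Finset.sum_add_distrib]
  refine Finset.sum_congr rfl fun γ hγ => ?_
  rw [Finset.mem_powerset] at hγ
  have heγ : e ∉ γ := fun hh => he (hγ hh)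
  have e1 : insert e N \ γ = insert e (N \ γ) := Finset.insert_sdiff_of_notMem _ heγ
  have e2 : insert e N \ insert e γ = N \ γ := by
    rw [Finset.insert_sdiff_insert, Finset.sdiff_insert_of_notMem he]
  have e3 : ∀ X Y : Finset (Sym2 V), insert y (insert e X ∪ Y) = insert e (X ∪ insert y Y) := fun X Y => by
    rw [Finset.insert_union, Finset.insert_comm, Finset.union_insert]
  have e4 : ∀ X Y : Finset (Sym2 V), insert y (X ∪ Y) = X ∪ insert y Y := fun X Y => (Finset.union_insert _ _ _).symm
  have e5 : ∀ X Y : Finset (Sym2 V), insert e X ∪ Y = insert e (X ∪ Y) := fun X Y => Finset.insert_union _ _ _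
  rw [e1, e2, Finset.erase_eq_of_notMem heγ, Finset.erase_insert heγ, e3, e3, e4, e4, e5, e5]
  simp only [Nat.add_comm]
  ring

omit [Fintype V] in
/-- **Root exchange (`e ∈ N`).**  If the root `e` is itself a free edge, `D^{e}(yC | C) − D^{e}(C | yC)` on `N` equals the rootless AND-contracted
drift `(yC | C)` of `N` against `h` plus the rootless `e`-contracted drift `(yCe | Ce)` of `N \ e` against `h + h(· ∪ e)`.
[cite: Grimmett2006, §1.4 eq. (1.20) (p. 15)] -/
theorem twoSidedW_diff_root_mem_eq (w : ℕ → ℝ) {N : Finset (Sym2 V)} (C : Finset (Sym2 V)) {e : Sym2 V} (y : Sym2 V) (he : e ∈ N)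
    (h : Finset (Sym2 V) → ℝ) :
    ∑ γ ∈ N.powerset,
        (w (clusterCount (↑(insert e (γ ∪ insert y C)) : BondConfig V) ∅ + clusterCount (↑(N \ γ ∪ C) : BondConfig V) ∅) -
          w (clusterCount (↑(insert e (N \ γ ∪ insert y C)) : BondConfig V) ∅ + clusterCount (↑(γ ∪ C) : BondConfig V) ∅)) * h γ -
      ∑ γ ∈ N.powerset,
        (w (clusterCount (↑(insert e (γ ∪ C)) : BondConfig V) ∅ + clusterCount (↑(N \ γ ∪ insert y C) : BondConfig V) ∅) -
          w (clusterCount (↑(insert e (N \ γ ∪ C)) : BondConfig V) ∅ + clusterCount (↑(γ ∪ insert y C) : BondConfig V) ∅)) * h γ =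
      ∑ γ ∈ N.powerset,
        (w (clusterCount (↑(γ ∪ insert y C) : BondConfig V) ∅ + clusterCount (↑(N \ γ ∪ C) : BondConfig V) ∅) -
          w (clusterCount (↑(N \ γ ∪ insert y C) : BondConfig V) ∅ + clusterCount (↑(γ ∪ C) : BondConfig V) ∅)) * h γ +
      ∑ γ ∈ (N.erase e).powerset,
        (w (clusterCount (↑(γ ∪ insert y (insert e C)) : BondConfig V) ∅ + clusterCount (↑(N.erase e \ γ ∪ insert e C) : BondConfig V) ∅) -
          w (clusterCount (↑(N.erase e \ γ ∪ insert y (insert e C)) : BondConfig V) ∅ + clusterCount (↑(γ ∪ insert e C) : BondConfig V) ∅)) *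
          (h γ + h (insert e γ)) := by
  set N' := N.erase e with hN'
  have hN : N = insert e N' := (Finset.insert_erase he).symm
  have heN' : e ∉ N' := Finset.notMem_erase _ _
  rw [hN, Finset.sum_powerset_insert heN', Finset.sum_powerset_insert heN', Finset.sum_powerset_insert heN']
  have e1 : ∀ γ ∈ N'.powerset, insert e N' \ γ = insert e (N' \ γ) := fun γ hγ =>
    Finset.insert_sdiff_of_notMem _ (fun hh => heN' (Finset.mem_powerset.1 hγ hh))
  have e2 : ∀ γ : Finset (Sym2 V), insert e N' \ insert e γ = N' \ γ := fun γ => by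
    rw [Finset.insert_sdiff_insert, Finset.sdiff_insert_of_notMem heN']
  have S1 : ∀ (A B : Finset (Sym2 V)) (φ : Finset (Sym2 V) → ℝ), ∑ γ ∈ N'.powerset,
      (w (clusterCount (↑(insert e (γ ∪ A)) : BondConfig V) ∅ + clusterCount (↑(insert e N' \ γ ∪ B) : BondConfig V) ∅) -
        w (clusterCount (↑(insert e (insert e N' \ γ ∪ A)) : BondConfig V) ∅ + clusterCount (↑(γ ∪ B) : BondConfig V) ∅)) * φ γ =
      ∑ γ ∈ N'.powerset,
      (w (clusterCount (↑(insert e (γ ∪ A)) : BondConfig V) ∅ + clusterCount (↑(insert e (N' \ γ ∪ B)) : BondConfig V) ∅) -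
        w (clusterCount (↑(insert e (N' \ γ ∪ A)) : BondConfig V) ∅ + clusterCount (↑(γ ∪ B) : BondConfig V) ∅)) * φ γ := by
    intro A B φ
    refine Finset.sum_congr rfl fun γ hγ => ?_
    rw [e1 γ hγ, Finset.insert_union, Finset.insert_union, Finset.insert_idem]
  have S2 : ∀ (A B : Finset (Sym2 V)) (φ : Finset (Sym2 V) → ℝ), ∑ γ ∈ N'.powerset,
      (w (clusterCount (↑(insert e (insert e γ ∪ A)) : BondConfig V) ∅ + clusterCount (↑(insert e N' \ insert e γ ∪ B) : BondConfig V) ∅) -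
        w (clusterCount (↑(insert e (insert e N' \ insert e γ ∪ A)) : BondConfig V) ∅ + clusterCount (↑(insert e γ ∪ B) : BondConfig V) ∅)) *
        φ γ =
      ∑ γ ∈ N'.powerset,
      (w (clusterCount (↑(insert e (γ ∪ A)) : BondConfig V) ∅ + clusterCount (↑(N' \ γ ∪ B) : BondConfig V) ∅) -
        w (clusterCount (↑(insert e (N' \ γ ∪ A)) : BondConfig V) ∅ + clusterCount (↑(insert e (γ ∪ B)) : BondConfig V) ∅)) * φ γ := by
    intro A B φ
    refine Finset.sum_congr rfl fun γ _ => ?_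
    rw [e2 γ, Finset.insert_union, Finset.insert_idem, Finset.insert_union]
  have S3 : ∀ (A B : Finset (Sym2 V)) (φ : Finset (Sym2 V) → ℝ), ∑ γ ∈ N'.powerset,
      (w (clusterCount (↑(insert e γ ∪ A) : BondConfig V) ∅ + clusterCount (↑(insert e N' \ insert e γ ∪ B) : BondConfig V) ∅) -
        w (clusterCount (↑(insert e N' \ insert e γ ∪ A) : BondConfig V) ∅ + clusterCount (↑(insert e γ ∪ B) : BondConfig V) ∅)) * φ γ =
      ∑ γ ∈ N'.powerset,
      (w (clusterCount (↑(insert e (γ ∪ A)) : BondConfig V) ∅ + clusterCount (↑(N' \ γ ∪ B) : BondConfig V) ∅) -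
        w (clusterCount (↑(N' \ γ ∪ A) : BondConfig V) ∅ + clusterCount (↑(insert e (γ ∪ B)) : BondConfig V) ∅)) * φ γ := by
    intro A B φ
    refine Finset.sum_congr rfl fun γ _ => ?_
    rw [e2 γ, Finset.insert_union, Finset.insert_union]
  have S4 : ∀ (A B : Finset (Sym2 V)) (φ : Finset (Sym2 V) → ℝ), ∑ γ ∈ N'.powerset,
      (w (clusterCount (↑(γ ∪ A) : BondConfig V) ∅ + clusterCount (↑(insert e N' \ γ ∪ B) : BondConfig V) ∅) -
        w (clusterCount (↑(insert e N' \ γ ∪ A) : BondConfig V) ∅ + clusterCount (↑(γ ∪ B) : BondConfig V) ∅)) * φ γ =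
      ∑ γ ∈ N'.powerset,
      (w (clusterCount (↑(γ ∪ A) : BondConfig V) ∅ + clusterCount (↑(insert e (N' \ γ ∪ B)) : BondConfig V) ∅) -
        w (clusterCount (↑(insert e (N' \ γ ∪ A)) : BondConfig V) ∅ + clusterCount (↑(γ ∪ B) : BondConfig V) ∅)) * φ γ := by
    intro A B φ
    refine Finset.sum_congr rfl fun γ hγ => ?_
    rw [e1 γ hγ, Finset.insert_union, Finset.insert_union]
  rw [S1, S2, S1, S2, S4, S3]
  have e5 : ∀ X : Finset (Sym2 V), X ∪ insert y (insert e C) = insert e (X ∪ insert y C) := fun X => by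
    rw [Finset.insert_comm, Finset.union_insert]
  have e6 : ∀ X : Finset (Sym2 V), X ∪ insert e C = insert e (X ∪ C) := fun X => Finset.union_insert _ _ _
  simp only [e5, e6, mul_add, Finset.sum_add_distrib]
  simp only [← Finset.sum_add_distrib, ← Finset.sum_sub_distrib]
  refine Finset.sum_congr rfl fun γ _ => ?_
  simp only [Nat.add_comm]
  ring

/-- **The signed difference `Δ = D^{uv}(yC | C) − D^{uv}(C | yC) ≤ 0` in every position of the (virtual) root `uv`.**  `F` TTSP between `u, v`,
`y ∈ F`, `N ⊆ F` free, `C ⊆ F` contracted, `y ∉ N ∪ C`, `N ∩ C = ∅`, `w` antitone, `h` monotone.  Cases: `uv ∉ F` or `uv` deleted — root exchange +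
the master theorem with root `y` on `(F ∪ {uv}) \ y` (Duffin re-rooting); `uv = y` or `uv ∈ C` — rootless AND-contracted drifts; `uv ∈ N` —
`FK.twoSidedW_diff_root_mem_eq` + two rootless drifts. [cite: Grimmett2006, §3.8 Thm. (3.90) (pp. 61–62); §3.9 (pp. 63–64)] -/
theorem majDiffW_nonpos_of_isTTSP {F : Finset (Sym2 V)} {u v : V} {N C : Finset (Sym2 V)} {y : Sym2 V} (hFT : IsTTSP F u v)
    (hy : y ∈ F) (hN : N ⊆ F) (hC : C ⊆ F) (hyN : y ∉ N) (hyC : y ∉ C) (hNC : Disjoint N C)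
    {w : ℕ → ℝ} (hw : ∀ k : ℕ, w (k + 1) ≤ w k)
    {h : Finset (Sym2 V) → ℝ} (hm : ∀ ⦃X Y : Finset (Sym2 V)⦄, X ⊆ Y → Y ⊆ N → h X ≤ h Y) :
    ∑ γ ∈ N.powerset,
        (w (clusterCount (↑(insert s(u, v) (γ ∪ insert y C)) : BondConfig V) ∅ + clusterCount (↑(N \ γ ∪ C) : BondConfig V) ∅) -
          w (clusterCount (↑(insert s(u, v) (N \ γ ∪ insert y C)) : BondConfig V) ∅ + clusterCount (↑(γ ∪ C) : BondConfig V) ∅)) * h γ -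
      ∑ γ ∈ N.powerset,
        (w (clusterCount (↑(insert s(u, v) (γ ∪ C)) : BondConfig V) ∅ + clusterCount (↑(N \ γ ∪ insert y C) : BondConfig V) ∅) -
          w (clusterCount (↑(insert s(u, v) (N \ γ ∪ C)) : BondConfig V) ∅ + clusterCount (↑(γ ∪ insert y C) : BondConfig V) ∅)) * h γ ≤ 0 := by
  revert hy hyN hyC
  refine Sym2.ind (fun a b => ?_) y
  intro hy hyN hyC
  -- the rootless AND-contracted drift `(yC | C)` of `N` is signed
  have hR : ∑ γ ∈ N.powerset,
      (w (clusterCount (↑(γ ∪ insert s(a, b) C) : BondConfig V) ∅ + clusterCount (↑(N \ γ ∪ C) : BondConfig V) ∅) -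
        w (clusterCount (↑(N \ γ ∪ insert s(a, b) C) : BondConfig V) ∅ + clusterCount (↑(γ ∪ C) : BondConfig V) ∅)) * h γ ≤ 0 :=
    andGenW_rootless_nonpos_of_isTTSP hFT hN ((Finset.insert_subset hy hC).trans (Finset.subset_insert _ _)) (Finset.subset_insert _ _)
      (Finset.disjoint_insert_right.2 ⟨hyN, hNC⟩) hw hm
  by_cases huvy : s(u, v) = s(a, b)
  · -- root = y: the first drift is rootless `(yC|C)`, the second vanishes
    have e1 : ∀ X : Finset (Sym2 V), insert s(u, v) (X ∪ insert s(a, b) C) = X ∪ insert s(a, b) C := fun X =>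
      Finset.insert_eq_of_mem (Finset.mem_union_right _ (huvy ▸ Finset.mem_insert_self _ _))
    have e2 : ∀ X : Finset (Sym2 V), insert s(u, v) (X ∪ C) = X ∪ insert s(a, b) C := fun X => by rw [huvy, Finset.union_insert]
    simp_rw [e1, e2]
    rw [andGenW_rootless_self w N (insert s(a, b) C) h, sub_zero]
    exact hR
  by_cases huvC : s(u, v) ∈ C
  · -- root contracted: both drifts rootless, the second is minus the first
    have e1 : ∀ X : Finset (Sym2 V), insert s(u, v) (X ∪ insert s(a, b) C) = X ∪ insert s(a, b) C := fun X =>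
      Finset.insert_eq_of_mem (Finset.mem_union_right _ (Finset.mem_insert_of_mem huvC))
    have e2 : ∀ X : Finset (Sym2 V), insert s(u, v) (X ∪ C) = X ∪ C := fun X => Finset.insert_eq_of_mem (Finset.mem_union_right _ huvC)
    simp_rw [e1, e2]
    have sw := twoSidedW_swap w N (insert s(a, b) C) C h
    linarith
  by_cases huvN : s(u, v) ∈ N
  · -- root free: `Δ = D°_N(yC|C)(h) + D°_{N∖uv}(yC uv|C uv)(h + h(·∪uv))`
    rw [twoSidedW_diff_root_mem_eq w C s(a, b) huvN h]
    have hN'N : N.erase s(u, v) ⊆ N := Finset.erase_subset _ _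
    have i₂ := andGenW_rootless_nonpos_of_isTTSP hFT (hN'N.trans hN) (A := insert s(a, b) (insert s(u, v) C)) (C := insert s(u, v) C)
      (Finset.insert_subset (Finset.mem_insert_of_mem hy) (Finset.insert_subset_insert _ hC)) (Finset.subset_insert _ _)
      (Finset.disjoint_insert_right.2 ⟨fun hh => hyN (hN'N hh), Finset.disjoint_insert_right.2 ⟨Finset.notMem_erase _ _,
        Finset.disjoint_of_subset_left hN'N hNC⟩⟩) hw (h := fun γ => h γ + h (insert s(u, v) γ))
      (fun X Y hXY hY => add_le_add (hm hXY (hY.trans hN'N))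
        (hm (Finset.insert_subset_insert _ hXY) (Finset.insert_subset huvN (hY.trans hN'N))))
    linarith
  · -- root outside the cell (outside `F` or deleted): root exchange, then the master theorem with root `y`
    rw [twoSidedW_diff_root_eq w C s(a, b) huvN h]
    have hne : insert s(u, v) F ≠ {s(a, b)} := by
      intro hh
      have : s(u, v) ∈ ({s(a, b)} : Finset (Sym2 V)) := hh ▸ Finset.mem_insert_self _ _
      rw [Finset.mem_singleton] at this
      exact huvy this
    have hE' : IsTTSP ((insert s(u, v) F).erase s(a, b)) a b := hFT.reroot_erase (Finset.mem_insert_of_mem hy) hne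
    exact andGenW_drift_nonpos_of_isTTSP _ le_rfl hE' (Finset.notMem_erase _ _)
      (N := insert s(u, v) N) (A := C) (C := C)
      (Finset.insert_subset (Finset.mem_erase.2 ⟨huvy, Finset.mem_insert_self _ _⟩)
        (fun f hf => Finset.mem_erase.2 ⟨fun hh => hyN (hh ▸ hf), Finset.mem_insert_of_mem (hN hf)⟩))
      (fun f hf => Finset.mem_erase.2 ⟨fun hh => hyC (hh ▸ hf), Finset.mem_insert_of_mem (hC hf)⟩) subset_rfl
      (Finset.disjoint_insert_left.2 ⟨huvC, hNC⟩) w hw (fun γ => h (γ.erase s(u, v)))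
      (fun X Y hXY hY => hm (Finset.erase_subset_erase _ hXY) (by
        intro f hf
        have hf' := hY (Finset.mem_of_mem_erase hf)
        rcases Finset.mem_insert.1 hf' with h' | h'
        · exact absurd h' (Finset.ne_of_mem_erase hf)
        · exact h'))

end MajSplitSides

end FK

end Summit.CriticalPhenomena.PercolationContinuityZ3.Theorems

end
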